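import Summits.ValiantsHypothesis.ValiantsHypothesis.Theorems.GrenetZeonDualUnipotentThreeHalvesLongMassFreeTriangularPrice
import Summits.ValiantsHypothesis.ValiantsHypothesis.Theorems.GrenetZeonDualUnipotentThreeHalvesLongMassNilSpaceEngelCriterion

/-!
# `GrenetZeon.DualUnipotentThreeHalves` (stmt-ValiantsHypothesis-24318), line `slow_core`, stub (c) `SlowCore.LongMassSlowLawInv`:
# ON THE TRIANGULARISABLE LOCUS THE OPTIMAL INTEGER CONSTANT OF (c) IS EXACTLY `2`

Calibration of the menu's triangularisable row.  ✓ `TriangularRow.relCert_of_triangularisable` prices a simultaneously strictly triangularisable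
affine pencil at `n·⌊(m−1)/h⌋ + ⌊m(h−1)/2⌋` for EVERY block size `h ≥ 1` and ✓ `relCert_of_triangularisable_sqrt` records the normal form with
`c = 3` (block size `⌊√n⌋ + 1`).  The block size `h = 2⌊√n⌋` gives the constant `2`:

* `price_two_le` — arithmetic: `a = ⌊√n⌋ ≥ 1` ⇒ `n·⌊(m−1)/(2a)⌋ + ⌊m(2a−1)/2⌋ ≤ 2·(a·m)`.
* ★★ `relCert_of_triangularisable_two` — `P·N·P⁻¹` strictly upper triangular (constant unit `P`) ⇒ `RelCert n m N (2·(⌊√n⌋·m))`, every `n, m`;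
  `relCert_of_strictUpper_two`, `relCert_of_valueSpace_triangularisable_two`; and through the Engel dictionary (✓ `NilSpaceEngel.…`)
  `relCert_of_valueSpace_lieClosed_two`, `relCert_of_valueSpace_words_eq_zero_two`; `longMass_on_triangularisable_locus_two` in the binder shape
  of the stub.
* ★★ `not_longMass_on_strictUpper_locus_one` — the constant `1` FAILS already for strictly upper triangular pencils (the free triangular pencil of
  ✓ `FreeTriangularPrice.not_relCert_sqrt_mul`, `n ≥ 100`).
* ★★★ `triangularisable_constant_eq_two` — the two together: «(c) restricted to the triangularisable locus holds with `c = 2`, `n₀ = 0`, and fails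
  with `c = 1` for every `n₀`» — the integer constant on this locus is EXACTLY `2` (the real rate is `√2`, ✓ `two_mul_sq_le_of_relCert` /
  ✓ `relCert_free_blocks`).

HONEST FRAMING.  Calibration (`--supports stmt-ValiantsHypothesis-24318`); says nothing about the research stub (c) `SlowCore.LongMassSlowLawInv` off the
triangularisable locus (its constant, if it exists, is `≥ 2` by ✓ `not_longMassSlowLawAll_one`); closes no stub; S3, 24318, 8062 and `VP ≠ VNP` are
NOT proved.  Def-free, no named-fact hypotheses, no sorry.
-/

set_option linter.dupNamespace false
set_option autoImplicit false

noncomputable section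

namespace Summit.ValiantsHypothesis.ValiantsHypothesis.Theorems.GrenetZeon.TriangularRow

open MvPolynomial Matrix
open scoped BigOperators
open Summit.ValiantsHypothesis.ValiantsHypothesis.Cruxes.TwoDimCoefficients.DimTwoCases (AffMat IsAffine)
open Summit.ValiantsHypothesis.ValiantsHypothesis.Theorems.GrenetZeon.SlowCore (RelCert)
open Summit.ValiantsHypothesis.ValiantsHypothesis.Theorems.GrenetZeon.FreeTriangularPrice (isAffine_free pow_eq_zero_free not_relCert_sqrt_mul)
open Summit.ValiantsHypothesis.ValiantsHypothesis.Theorems.GrenetZeon.NilSpaceEngel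
  (exists_unit_conj_strictUpper_of_lieClosed exists_unit_conj_strictUpper_of_words_eq_zero)

variable {n m : ℕ}

/-! ## §1 Arithmetic of the block size `2⌊√n⌋` -/

/-- Pure arithmetic: `a ≥ 1`, `n ≤ a² + 2a`, `2a·q ≤ m − 1`, `2r ≤ m(2a − 1)` ⇒ `n·q + r ≤ 2·a·m`. -/
theorem price_two_aux (a m n q r : ℕ) (ha : 1 ≤ a) (hn : n ≤ a * a + 2 * a) (hq : q * (2 * a) ≤ m - 1)
    (hr : r * 2 ≤ m * (2 * a - 1)) : n * q + r ≤ 2 * (a * m) := by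
  rcases Nat.eq_zero_or_pos m with hm | hm
  · subst hm
    have hq0 : q = 0 := by
      rcases Nat.eq_zero_or_pos q with h | h
      · exact h
      · exfalso
        have : 1 * (2 * 1) ≤ q * (2 * a) := Nat.mul_le_mul h (Nat.mul_le_mul_left 2 ha)
        omega
    have hr0 : r = 0 := by omega
    subst hq0; subst hr0; simp
  · obtain ⟨a', rfl⟩ : ∃ a', a = a' + 1 := ⟨a - 1, by omega⟩
    obtain ⟨m', rfl⟩ : ∃ m', m = m' + 1 := ⟨m - 1, by omega⟩
    have e1 : m' + 1 - 1 = m' := by omega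
    have e2 : 2 * (a' + 1) - 1 = 2 * a' + 1 := by omega
    rw [e1] at hq
    rw [e2] at hr
    -- `2nq ≤ (a'+3)·m'`
    have h1 : n * q ≤ (a' + 1) * (a' + 3) * q := Nat.mul_le_mul_right q (by nlinarith)
    have h2 : (a' + 3) * (q * (2 * (a' + 1))) ≤ (a' + 3) * m' := Nat.mul_le_mul_left _ hq
    nlinarith [h1, h2, hr]

/-- With `a = ⌊√n⌋ ≥ 1` (so `n ≤ a² + 2a`): `n·⌊(m−1)/(2a)⌋ + ⌊m·(2a−1)/2⌋ ≤ 2·(a·m)`. -/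
theorem price_two_le (n m : ℕ) (ha : 1 ≤ Nat.sqrt n) :
    n * ((m - 1) / (2 * Nat.sqrt n)) + m * (2 * Nat.sqrt n - 1) / 2 ≤ 2 * (Nat.sqrt n * m) := by
  have hn : n < (Nat.sqrt n + 1) * (Nat.sqrt n + 1) := Nat.lt_succ_sqrt n
  refine price_two_aux (Nat.sqrt n) m n _ _ ha (by nlinarith [hn]) (Nat.div_mul_le_self _ _) (Nat.div_mul_le_self _ _)

/-! ## §2 The triangularisable row at `c = 2` -/

/-- ★★ **THE TRIANGULARISABLE ROW WITH `c = 2`.**  `P·N·P⁻¹` strictly upper triangular (constant unit `P`) ⇒ `RelCert n m N (2·(⌊√n⌋·m))`,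
for every `n, m` (block size `2⌊√n⌋`; for `n = 0` the freeze certificate). -/
theorem relCert_of_triangularisable_two (N : AffMat n m) (hN : IsAffine N)
    (P : (Matrix (Fin m) (Fin m) ℂ)ˣ)
    (htri : ∀ i j : Fin m, j ≤ i →
      ((P : Matrix (Fin m) (Fin m) ℂ).map C * N * (↑P⁻¹ : Matrix (Fin m) (Fin m) ℂ).map C : AffMat n m) i j = 0) :
    RelCert n m N (2 * (Nat.sqrt n * m)) := by
  rcases Nat.eq_zero_or_pos (Nat.sqrt n) with ha | ha
  · -- `⌊√n⌋ = 0` means `n = 0`: the trivial certificate (block size `1`: price `n·(m−1) + 0 = 0`)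
    have hn : n = 0 := by
      have := Nat.lt_succ_sqrt n
      rw [ha] at this
      omega
    have h := relCert_of_triangularisable N hN P htri 1 le_rfl
    subst hn
    simpa using h
  · exact relCert_mono (relCert_of_triangularisable N hN P htri (2 * Nat.sqrt n) (by omega)) (price_two_le n m ha)

/-- **`P = 1`**: a strictly upper triangular affine pencil has price `≤ 2·⌊√n⌋·m`. -/
theorem relCert_of_strictUpper_two (N : AffMat n m) (hN : IsAffine N) (htri : ∀ i j : Fin m, j ≤ i → N i j = 0) :
    RelCert n m N (2 * (Nat.sqrt n * m)) := by
  refine relCert_of_triangularisable_two N hN 1 (fun i j hji => ?_)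
  rw [inv_one, Units.val_one, Matrix.map_one C C_0 C_1, Matrix.one_mul, Matrix.mul_one]
  exact htri i j hji

/-- **Value-space form at `c = 2`**: every value `N(x)` in one space conjugated by a unit `P` into the strictly upper triangular matrices. -/
theorem relCert_of_valueSpace_triangularisable_two (N : AffMat n m) (hN : IsAffine N)
    (V : Submodule ℂ (Matrix (Fin m) (Fin m) ℂ)) (hV : ∀ x : Fin n × Fin n → ℂ, N.map (MvPolynomial.eval x) ∈ V)
    (P : (Matrix (Fin m) (Fin m) ℂ)ˣ)
    (hP : ∀ A ∈ V, ∀ i j : Fin m, j ≤ i →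
      ((P : Matrix (Fin m) (Fin m) ℂ) * A * (↑P⁻¹ : Matrix (Fin m) (Fin m) ℂ)) i j = 0) :
    RelCert n m N (2 * (Nat.sqrt n * m)) := by
  refine relCert_of_triangularisable_two N hN P (fun i j hji => ?_)
  apply MvPolynomial.funext
  intro x
  have h1 : MvPolynomial.eval x (((P : Matrix (Fin m) (Fin m) ℂ).map C * N *
      (↑P⁻¹ : Matrix (Fin m) (Fin m) ℂ).map C : AffMat n m) i j) =
      ((P : Matrix (Fin m) (Fin m) ℂ) * N.map (MvPolynomial.eval x) * (↑P⁻¹ : Matrix (Fin m) (Fin m) ℂ)) i j := by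
    have hPC : ((P : Matrix (Fin m) (Fin m) ℂ).map C).map (MvPolynomial.eval x) = (P : Matrix (Fin m) (Fin m) ℂ) := by
      rw [Matrix.map_map]; ext a c; simp
    have hQC : ((↑P⁻¹ : Matrix (Fin m) (Fin m) ℂ).map C).map (MvPolynomial.eval x) = (↑P⁻¹ : Matrix (Fin m) (Fin m) ℂ) := by
      rw [Matrix.map_map]; ext a c; simp
    rw [← Matrix.map_apply (f := MvPolynomial.eval x), Matrix.map_mul, Matrix.map_mul, hPC, hQC]
  rw [h1, map_zero]
  exact hP _ (hV x) i j hji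

/-- **ENGEL ROW at `c = 2`**: values in a Lie-closed space of nilpotent matrices. -/
theorem relCert_of_valueSpace_lieClosed_two (N : AffMat n m) (hN : IsAffine N)
    (V : Submodule ℂ (Matrix (Fin m) (Fin m) ℂ)) (hV : ∀ x : Fin n × Fin n → ℂ, N.map (MvPolynomial.eval x) ∈ V)
    (hnil : ∀ A ∈ V, IsNilpotent A) (hlie : ∀ A ∈ V, ∀ B ∈ V, A * B - B * A ∈ V) :
    RelCert n m N (2 * (Nat.sqrt n * m)) := by
  obtain ⟨P, hP⟩ := exists_unit_conj_strictUpper_of_lieClosed V hnil hlie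
  exact relCert_of_valueSpace_triangularisable_two N hN V hV P hP

/-- **WORD ROW at `c = 2`**: values in a space all of whose words of some length vanish. -/
theorem relCert_of_valueSpace_words_eq_zero_two (N : AffMat n m) (hN : IsAffine N)
    (V : Submodule ℂ (Matrix (Fin m) (Fin m) ℂ)) (hV : ∀ x : Fin n × Fin n → ℂ, N.map (MvPolynomial.eval x) ∈ V) {s : ℕ}
    (hwords : ∀ w : Fin s → Matrix (Fin m) (Fin m) ℂ, (∀ t, w t ∈ V) → (List.ofFn w).prod = 0) :
    RelCert n m N (2 * (Nat.sqrt n * m)) := by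
  obtain ⟨P, hP⟩ := exists_unit_conj_strictUpper_of_words_eq_zero V hwords
  exact relCert_of_valueSpace_triangularisable_two N hN V hV P hP

/-- **(c) ON THE TRIANGULARISABLE LOCUS WITH `c = 2`, `n₀ = 0`**, in the binder shape of the stub. -/
theorem longMass_on_triangularisable_locus_two :
    ∀ n b : ℕ, ∀ B : AffMat n b, IsAffine B →
      (∃ P : (Matrix (Fin b) (Fin b) ℂ)ˣ, ∀ i j : Fin b, j ≤ i →
        ((P : Matrix (Fin b) (Fin b) ℂ).map C * B * (↑P⁻¹ : Matrix (Fin b) (Fin b) ℂ).map C : AffMat n b) i j = 0) →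
      RelCert n b B (2 * (Nat.sqrt n * b)) := by
  intro n b B hB hP
  obtain ⟨P, htri⟩ := hP
  exact relCert_of_triangularisable_two B hB P htri

/-! ## §3 The constant `1` fails on the same locus -/

/-- ★★ **`c = 1` FAILS ON THE STRICTLY UPPER TRIANGULAR LOCUS** (for every threshold `n₀`): the free triangular `n × n` pencil, `n ≥ 100`
(✓ `FreeTriangularPrice.not_relCert_sqrt_mul`). -/
theorem not_longMass_on_strictUpper_locus_one :
    ¬ ∃ n₀ : ℕ, ∀ n ≥ n₀, ∀ b : ℕ, ∀ B : AffMat n b, IsAffine B → (∀ i j : Fin b, j ≤ i → B i j = 0) →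
      RelCert n b B (1 * (Nat.sqrt n * b)) := by
  rintro ⟨n₀, h⟩
  set n := max n₀ 100 with hn
  set N : AffMat n n := Matrix.of fun i j => if i < j then X (i, j) else 0 with hNdef
  have hN : ∀ i j, N i j = if i < j then X ((id i : Fin n), (id j : Fin n)) else 0 := fun i j => rfl
  have htri : ∀ i j : Fin n, j ≤ i → N i j = 0 := fun i j hji => by
    rw [hN, if_neg (not_lt.mpr hji)]
  have h1 := h n (le_max_left _ _) n N (isAffine_free id N hN) htri
  rw [one_mul] at h1
  exact not_relCert_sqrt_mul (le_max_right _ _) N hN h1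

/-- ★★★ **ON THE TRIANGULARISABLE LOCUS THE INTEGER CONSTANT OF (c) IS EXACTLY `2`.**  With
`T(c, n₀) :=` «every affine pencil `B` over `n ≥ n₀` coordinates that a constant unit conjugates into the strictly upper triangular matrices has
`RelCert n b B (c·(⌊√n⌋·b))`»: `T(2, 0)` holds and `T(1, n₀)` fails for every `n₀`. -/
theorem triangularisable_constant_eq_two :
    (∀ n b : ℕ, ∀ B : AffMat n b, IsAffine B →
      (∃ P : (Matrix (Fin b) (Fin b) ℂ)ˣ, ∀ i j : Fin b, j ≤ i →
        ((P : Matrix (Fin b) (Fin b) ℂ).map C * B * (↑P⁻¹ : Matrix (Fin b) (Fin b) ℂ).map C : AffMat n b) i j = 0) →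
      RelCert n b B (2 * (Nat.sqrt n * b))) ∧
    ¬ ∃ n₀ : ℕ, ∀ n ≥ n₀, ∀ b : ℕ, ∀ B : AffMat n b, IsAffine B →
      (∃ P : (Matrix (Fin b) (Fin b) ℂ)ˣ, ∀ i j : Fin b, j ≤ i →
        ((P : Matrix (Fin b) (Fin b) ℂ).map C * B * (↑P⁻¹ : Matrix (Fin b) (Fin b) ℂ).map C : AffMat n b) i j = 0) →
      RelCert n b B (1 * (Nat.sqrt n * b)) := by
  refine ⟨longMass_on_triangularisable_locus_two, ?_⟩
  rintro ⟨n₀, h⟩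
  refine not_longMass_on_strictUpper_locus_one ⟨n₀, fun n hn b B hB htri => h n hn b B hB ⟨1, fun i j hji => ?_⟩⟩
  rw [inv_one, Units.val_one, Matrix.map_one C C_0 C_1, Matrix.one_mul, Matrix.mul_one]
  exact htri i j hji

end Summit.ValiantsHypothesis.ValiantsHypothesis.Theorems.GrenetZeon.TriangularRow

end
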